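import Summits.Ventures.DiscreteObjects.PP12.FlagExterior

/-!
# PP(12), flag sub-cell `f = 10`: the odd-point map is a σ-equivariant permutation of the exterior points (kernel)
Framing: lottery ticket; floor = certified bounds/negative ranges.

Cell pub-namedobj (venture DiscreteObjects), target (M), designs gen 11. Setting: a collineation `σ` of a projective plane of order 12
with `σ³ = 1` of FLAG type with exactly `10` fixed points (`FlagExterior`: 36 exterior points in 12 orbit-triangles, every exterior
line is a side of exactly one triangle and carries exactly 3 exterior points). For an exterior point `Q` let `odd Q` be the third
exterior point of the side `Q·σQ` (`exterior_line_three_of_flag_ten`). This file proves the combinatorial facts behind the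
'Latin-square reduction' of the sub-cell (designs g10 FAMILY-P5PLANE §7, designs g11 FAMILY-FLAG10 §1):
* `exterior_lines_through_le_three` — an exterior point lies on at most `13 − 10 = 3` lines through no fixed point (the 10 lines to
  the fixed points are distinct and not exterior);
* `oddPoint_spec` — the odd point of the side `Q·σQ` exists, is exterior, lies outside the orbit of `Q`, and is the only exterior
  point of that side besides `Q, σQ`;
* `oddPoint_injective` — two sides with the same odd point coincide (else that point would lie on four exterior lines: its own two
  sides and the two given ones); hence the odd-point relation is a permutation of the 36 exterior points, and it commutes with `σ`
  (`oddPoint_equivariant`). On orbits this is the fixed-point-free permutation `φ⁻¹` of FAMILY-FLAG10 ('triangle `i` is inscribed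
  in triangle `φ(i)`').
Elementary; no `sorry`, no new axioms, no new definitions (all statements relational).
-/

namespace Summit.Ventures.DiscreteObjects.PP12

open Configuration Finset
open scoped Classical

namespace Collineation

variable {P L : Type*} [Membership P L] [ProjectivePlane P L] [Fintype P] [Fintype L]
  [DecidableEq P] [DecidableEq L] (σ : Collineation P L)

section FlagTen

variable {l : L} {c : P} (hl : σ.onLines l = l) (hc : σ.onPoints c = c) (hcl : c ∈ l)
  (hP : ∀ p : P, σ.onPoints p = p → p ∈ l) (hL : ∀ m : L, σ.onLines m = m → c ∈ m)
  (h12 : ProjectivePlane.order P L = 12) (hq : σ.onPoints ^ 3 = 1) (hf : fixedCard σ.onPoints = 10)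

/-- The lines through an exterior point `Q` that contain no fixed point are at most `13 − f` in number: the `f` lines joining
`Q` to the fixed points are pairwise distinct (two fixed points and an exterior point are never collinear). Here `f = 10`. -/
theorem exterior_lines_through_le_three (h12 : ProjectivePlane.order P L = 12) (hf : fixedCard σ.onPoints = 10) {Q : P}
    (hQ : ∀ m : L, σ.onLines m = m → Q ∉ m) :
    (univ.filter fun x : L => Q ∈ x ∧ ∀ p : P, σ.onPoints p = p → p ∉ x).card ≤ 3 := by
  set Fx : Finset P := univ.filter fun p : P => σ.onPoints p = p with hFx
  have hFcard : Fx.card = 10 := hf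
  set LQ : Finset L := univ.filter fun x : L => Q ∈ x with hLQ
  have hLQ13 : LQ.card = 13 := by
    rw [hLQ, ← Fintype.card_subtype, ← Nat.card_eq_fintype_card]
    have := ProjectivePlane.lineCount_eq L Q
    rw [h12] at this; exact this
  -- the line Q·y for a fixed point y
  have hQne : ∀ y ∈ Fx, Q ≠ y := by
    intro y hy e
    subst e
    have fy : σ.onPoints Q = Q := by simpa [hFx] using hy
    -- y is fixed, so y lies on the fixed line through... use: a fixed point lies on some fixed line? we only need Q not fixed:
    -- Q = y fixed contradicts: the line through y and another fixed point is fixed and contains Q.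
    obtain ⟨y', hy', hyy'⟩ : ∃ y' ∈ Fx, y' ≠ Q := by
      have h2 : 1 < Fx.card := by rw [hFcard]; norm_num
      obtain ⟨a, ha, b, hb, hab⟩ := Finset.one_lt_card.mp h2
      by_cases hay : a = Q
      · exact ⟨b, hb, fun e' => hab (hay.trans e'.symm)⟩
      · exact ⟨a, ha, hay⟩
    have fy' : σ.onPoints y' = y' := by simpa [hFx] using hy'
    have hfixed := σ.line_fixed_of_two_fixed (HasLines.mkLine_ax (L := L) hyy').1 (HasLines.mkLine_ax hyy').2 hyy' fy' fy
    exact hQ _ hfixed (HasLines.mkLine_ax hyy').2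
  haveI : Nonempty L := Fintype.card_pos_iff.mp (by rw [ProjectivePlane.card_lines P L]; positivity)
  let g : P → L := fun y => if h : Q ≠ y then HasLines.mkLine h else Classical.arbitrary L
  have hg : ∀ y ∈ Fx, Q ∈ g y ∧ y ∈ g y := fun y hy => by
    simp only [g, dif_pos (hQne y hy)]; exact HasLines.mkLine_ax (hQne y hy)
  have hginj : Set.InjOn g Fx := by
    intro y hy y' hy' heq
    by_contra hne
    have fy : σ.onPoints y = y := by simpa [hFx] using hy
    have fy' : σ.onPoints y' = y' := by simpa [hFx] using hy'
    have h1 := hg y hy; have h2 := hg y' hy'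
    rw [← heq] at h2
    exact hQ (g y) (σ.line_fixed_of_two_fixed h1.2 h2.2 hne fy fy') h1.1
  -- the image of g lies in LQ and is disjoint from the exterior lines through Q
  have hsub : Fx.image g ∪ (univ.filter fun x : L => Q ∈ x ∧ ∀ p : P, σ.onPoints p = p → p ∉ x) ⊆ LQ := by
    intro x hx
    rcases Finset.mem_union.mp hx with hx | hx
    · obtain ⟨y, hy, rfl⟩ := Finset.mem_image.mp hx
      simp [hLQ, (hg y hy).1]
    · simp only [mem_filter, mem_univ, true_and] at hx; simp [hLQ, hx.1]
  have hdisj : Disjoint (Fx.image g) (univ.filter fun x : L => Q ∈ x ∧ ∀ p : P, σ.onPoints p = p → p ∉ x) := by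
    rw [Finset.disjoint_left]
    intro x hx hx'
    obtain ⟨y, hy, rfl⟩ := Finset.mem_image.mp hx
    have fy : σ.onPoints y = y := by simpa [hFx] using hy
    simp only [mem_filter, mem_univ, true_and] at hx'
    exact hx'.2 y fy (hg y hy).2
  have hcard := Finset.card_le_card hsub
  rw [Finset.card_union_of_disjoint hdisj, Finset.card_image_of_injOn hginj, hFcard, hLQ13] at hcard
  omega

include hl hc hcl hP hL h12 hq hf in
/-- **The odd point.** For an exterior point `Q` there is an exterior point `R` on the side `Q·σQ` outside the orbit of `Q`, and it
is the only exterior point of that side other than `Q` and `σQ`. -/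
theorem oddPoint_spec {Q : P} (hQ : σ.onPoints Q ≠ Q ∧ ∀ m : L, σ.onLines m = m → Q ∉ m) :
    ∃ R : P, (σ.onPoints R ≠ R ∧ ∀ m : L, σ.onLines m = m → R ∉ m) ∧ R ∈ (HasLines.mkLine hQ.1.symm : L) ∧
      R ≠ Q ∧ R ≠ σ.onPoints Q ∧ R ≠ σ.onPoints (σ.onPoints Q) ∧
      ∀ R' : P, (σ.onPoints R' ≠ R' ∧ ∀ m : L, σ.onLines m = m → R' ∉ m) → R' ∈ (HasLines.mkLine hQ.1.symm : L) →
        R' ≠ Q → R' ≠ σ.onPoints Q → R' = R := by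
  set x : L := HasLines.mkLine hQ.1.symm with hx
  have hQx : Q ∈ x := (HasLines.mkLine_ax hQ.1.symm).1
  have hσQx : σ.onPoints Q ∈ x := (HasLines.mkLine_ax hQ.1.symm).2
  obtain ⟨hnx, hxext⟩ := σ.side_no_fixed_point hQ.1 hQ.2 hQx hσQx
  obtain ⟨hcount, Q₀, R, hQ₀, hQ₀x, hσQ₀x, hR, hRx, hRQ₀, hRσQ₀, hRσσQ₀⟩ :=
    σ.exterior_line_three_of_flag_ten hl hc hcl hP hL h12 hq hf hnx hxext
  -- the orbit pair on x is Q's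
  have e0 : Q₀ = Q := σ.side_unique hQ.2 hQx hσQx hQ₀x hσQ₀x
  subst e0
  refine ⟨R, hR, hRx, hRQ₀, hRσQ₀, hRσσQ₀, fun R' hR' hR'x h1 h2 => ?_⟩
  -- the exterior points of x are exactly three: Q, σQ, R
  set Xx : Finset P := univ.filter fun y : P => y ∈ x ∧ σ.onPoints y ≠ y ∧ ∀ m : L, σ.onLines m = m → y ∉ m with hXx
  have hσQX : σ.onPoints (σ.onPoints Q₀) ≠ σ.onPoints Q₀ ∧ ∀ m : L, σ.onLines m = m → σ.onPoints Q₀ ∉ m :=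
    ⟨(σ.sq_ne_of_cube hq hQ.1).2, fun m hm hσQm => hQ.2 m hm ((σ.mem_fixedLine_iff hm Q₀).mp hσQm)⟩
  have hsub : ({Q₀, σ.onPoints Q₀, R, R'} : Finset P) ⊆ Xx := by
    intro y hy
    simp only [Finset.mem_insert, Finset.mem_singleton] at hy
    rcases hy with rfl | rfl | rfl | rfl
    · exact Finset.mem_filter.mpr ⟨Finset.mem_univ _, hQx, hQ.1, hQ.2⟩
    · exact Finset.mem_filter.mpr ⟨Finset.mem_univ _, hσQx, hσQX.1, hσQX.2⟩
    · exact Finset.mem_filter.mpr ⟨Finset.mem_univ _, hRx, hR.1, hR.2⟩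
    · exact Finset.mem_filter.mpr ⟨Finset.mem_univ _, hR'x, hR'.1, hR'.2⟩
  by_contra hne
  have h4 : ({Q₀, σ.onPoints Q₀, R, R'} : Finset P).card = 4 := by
    rw [Finset.card_insert_of_notMem, Finset.card_insert_of_notMem, Finset.card_pair (Ne.symm hne)]
    · simp only [Finset.mem_insert, Finset.mem_singleton, not_or]; exact ⟨hRσQ₀.symm, h2.symm⟩
    · simp only [Finset.mem_insert, Finset.mem_singleton, not_or]; exact ⟨hQ.1.symm, hRQ₀.symm, h1.symm⟩
  have := Finset.card_le_card hsub
  rw [h4, hcount] at this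
  omega

include hq in
omit [Fintype P] [Fintype L] [DecidableEq P] [DecidableEq L] in
/-- **σ-equivariance (relational form):** if `R` is an odd point for `Q` (exterior, on the side `Q·σQ`, not `Q`, `σQ`), then `σR`
is an odd point for `σQ`. -/
theorem oddPoint_equivariant {Q R : P} (hQ : σ.onPoints Q ≠ Q ∧ ∀ m : L, σ.onLines m = m → Q ∉ m)
    (hR : σ.onPoints R ≠ R ∧ ∀ m : L, σ.onLines m = m → R ∉ m) (hRx : R ∈ (HasLines.mkLine hQ.1.symm : L))
    (hRQ : R ≠ Q) (hRσQ : R ≠ σ.onPoints Q) :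
    let hσQ : σ.onPoints (σ.onPoints Q) ≠ σ.onPoints Q := (σ.sq_ne_of_cube hq hQ.1).2
    (σ.onPoints (σ.onPoints R) ≠ σ.onPoints R ∧ ∀ m : L, σ.onLines m = m → σ.onPoints R ∉ m) ∧
      σ.onPoints R ∈ (HasLines.mkLine hσQ.symm : L) ∧ σ.onPoints R ≠ σ.onPoints Q ∧
      σ.onPoints R ≠ σ.onPoints (σ.onPoints Q) := by
  intro hσQ
  refine ⟨⟨(σ.sq_ne_of_cube hq hR.1).2, fun m hm h => hR.2 m hm ((σ.mem_fixedLine_iff hm R).mp h)⟩, ?_,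
    fun e => hRQ (σ.onPoints.injective e), fun e => hRσQ (σ.onPoints.injective e)⟩
  -- the side of σQ is σ (side of Q)
  have h1 : σ.onPoints Q ∈ σ.onLines (HasLines.mkLine hQ.1.symm : L) := σ.mem_map (HasLines.mkLine_ax hQ.1.symm).1
  have h2 : σ.onPoints (σ.onPoints Q) ∈ σ.onLines (HasLines.mkLine hQ.1.symm : L) :=
    σ.mem_map (HasLines.mkLine_ax hQ.1.symm).2
  have hx' : (HasLines.mkLine hσQ.symm : L) = σ.onLines (HasLines.mkLine hQ.1.symm : L) :=
    (Nondegenerate.eq_or_eq (HasLines.mkLine_ax hσQ.symm).1 (HasLines.mkLine_ax hσQ.symm).2 h1 h2).resolve_left hσQ.symm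
  rw [hx']; exact σ.mem_map hRx

include h12 hq hf in
/-- **Injectivity (relational form):** an exterior point `R` is an odd point for at most one exterior `Q`. (If `R` were the odd
point of two different sides, `R` would lie on four lines through no fixed point — the two sides and its own sides `R·σR`,
`σ²R·R` — against `exterior_lines_through_le_three`.) With `oddPoint_spec` (existence and uniqueness on each side) the odd-point
relation is therefore a PERMUTATION of the 36 exterior points, commuting with `σ` (`oddPoint_equivariant`) and moving every point
off its own orbit. -/
theorem oddPoint_injective {Q Q' R : P} (hQ : σ.onPoints Q ≠ Q ∧ ∀ m : L, σ.onLines m = m → Q ∉ m)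
    (hQ' : σ.onPoints Q' ≠ Q' ∧ ∀ m : L, σ.onLines m = m → Q' ∉ m)
    (hR : σ.onPoints R ≠ R ∧ ∀ m : L, σ.onLines m = m → R ∉ m)
    (hRx : R ∈ (HasLines.mkLine hQ.1.symm : L)) (hRQ : R ≠ Q) (hRσQ : R ≠ σ.onPoints Q)
    (hRx' : R ∈ (HasLines.mkLine hQ'.1.symm : L)) (hRQ' : R ≠ Q') (hRσQ' : R ≠ σ.onPoints Q') : Q = Q' := by
  by_contra hne
  set x : L := HasLines.mkLine hQ.1.symm
  set x' : L := HasLines.mkLine hQ'.1.symm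
  have hQx : Q ∈ x := (HasLines.mkLine_ax hQ.1.symm).1
  have hσQx : σ.onPoints Q ∈ x := (HasLines.mkLine_ax hQ.1.symm).2
  have hQ'x' : Q' ∈ x' := (HasLines.mkLine_ax hQ'.1.symm).1
  have hσQ'x' : σ.onPoints Q' ∈ x' := (HasLines.mkLine_ax hQ'.1.symm).2
  -- the two sides are different lines
  have hxx' : x ≠ x' := fun e => hne ((σ.side_unique hQ.2 hQx hσQx (e ▸ hQ'x') (e ▸ hσQ'x'))).symm
  -- R's own sides
  have h3R : σ.onPoints (σ.onPoints (σ.onPoints R)) = R := by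
    have := congrArg (fun τ : Equiv.Perm P => τ R) hq
    simpa [pow_succ, Equiv.Perm.mul_apply] using this
  set s1 : L := HasLines.mkLine hR.1.symm   -- R · σR
  have hRs1 : R ∈ s1 := (HasLines.mkLine_ax hR.1.symm).1
  have hσRs1 : σ.onPoints R ∈ s1 := (HasLines.mkLine_ax hR.1.symm).2
  have hσσR : σ.onPoints (σ.onPoints R) ≠ R := (σ.sq_ne_of_cube hq hR.1).1
  set s2 : L := HasLines.mkLine hσσR    -- σ²R · R
  have hσσRs2 : σ.onPoints (σ.onPoints R) ∈ s2 := (HasLines.mkLine_ax hσσR).1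
  have hRs2 : R ∈ s2 := (HasLines.mkLine_ax hσσR).2
  have hσσRX : σ.onPoints (σ.onPoints (σ.onPoints R)) ≠ σ.onPoints (σ.onPoints R) ∧
      ∀ m : L, σ.onLines m = m → σ.onPoints (σ.onPoints R) ∉ m := by
    refine ⟨by rw [h3R]; exact hσσR.symm, fun m hm h => hR.2 m hm ?_⟩
    have := (σ.mem_fixedLine_iff hm (σ.onPoints R)).mp h
    exact (σ.mem_fixedLine_iff hm R).mp this
  -- all four lines contain no fixed point
  have ex1 := (σ.side_no_fixed_point hQ.1 hQ.2 hQx hσQx).2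
  have ex2 := (σ.side_no_fixed_point hQ'.1 hQ'.2 hQ'x' hσQ'x').2
  have ex3 := (σ.side_no_fixed_point hR.1 hR.2 hRs1 hσRs1).2
  have hs2' : σ.onPoints (σ.onPoints (σ.onPoints R)) ∈ s2 := by rw [h3R]; exact hRs2
  have ex4 := (σ.side_no_fixed_point hσσRX.1 hσσRX.2 hσσRs2 hs2').2
  -- they are pairwise distinct
  have hs12 : s1 ≠ s2 := by
    intro e
    exact (σ.orbit_triangle hq hR.1 hR.2).2.2.2 s1 hRs1 hσRs1 (e ▸ hσσRs2)
  have hx1 : x ≠ s1 := fun e => hRQ (σ.side_unique hQ.2 hQx hσQx (e ▸ hRs1) (e ▸ hσRs1))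
  have hx'1 : x' ≠ s1 := fun e => hRQ' (σ.side_unique hQ'.2 hQ'x' hσQ'x' (e ▸ hRs1) (e ▸ hσRs1))
  have hx2 : x ≠ s2 := fun e => hRσQ (by
    have := σ.side_unique hQ.2 hQx hσQx (e ▸ hσσRs2) (e ▸ hs2')
    rw [← this, h3R])
  have hx'2 : x' ≠ s2 := fun e => hRσQ' (by
    have := σ.side_unique hQ'.2 hQ'x' hσQ'x' (e ▸ hσσRs2) (e ▸ hs2')
    rw [← this, h3R])
  have hsub : ({x, x', s1, s2} : Finset L) ⊆ univ.filter fun y : L => R ∈ y ∧ ∀ p : P, σ.onPoints p = p → p ∉ y := by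
    intro y hy
    simp only [Finset.mem_insert, Finset.mem_singleton] at hy
    rcases hy with rfl | rfl | rfl | rfl
    · exact Finset.mem_filter.mpr ⟨Finset.mem_univ _, hRx, ex1⟩
    · exact Finset.mem_filter.mpr ⟨Finset.mem_univ _, hRx', ex2⟩
    · exact Finset.mem_filter.mpr ⟨Finset.mem_univ _, hRs1, ex3⟩
    · exact Finset.mem_filter.mpr ⟨Finset.mem_univ _, hRs2, ex4⟩
  have h4 : ({x, x', s1, s2} : Finset L).card = 4 := by
    rw [Finset.card_insert_of_notMem, Finset.card_insert_of_notMem, Finset.card_pair hs12]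
    · simp only [Finset.mem_insert, Finset.mem_singleton, not_or]; exact ⟨hx'1, hx'2⟩
    · simp only [Finset.mem_insert, Finset.mem_singleton, not_or]; exact ⟨hxx', hx1, hx2⟩
  have hle := σ.exterior_lines_through_le_three h12 hf hR.2
  have := Finset.card_le_card hsub
  rw [h4] at this
  omega

end FlagTen

end Collineation

end Summit.Ventures.DiscreteObjects.PP12
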